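import Summits.CriticalPhenomena.PercolationContinuityZ3.Theorems.PercNearOneGluingNoHeavyLowerTailKnQuestion8CoefficientwiseCoreClassKernelMixBundleBoundary
import Summits.CriticalPhenomena.PercolationContinuityZ3.Theorems.PercNearOneGluingNoHeavyLowerTailKnQuestion8CoefficientwiseCoreClassKernelMixIETLayerCake
import HarnessLib

/-!
# Boundary inequality on bundles, VI: the boundary IET for ALL monotone real levels

Support file (`--supports stmt-CriticalPhenomena-4575`, closed), prover `prim-cplus-coupling` (gen 46).  No definitions, no notations, no named facts,
no sorries; standard axioms.  Memo `prim-cplus-coupling/A5-COUPLING-gen45.md` §3.9, remark after the statement ('by the layer cake this is a real-level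
inequality as well').

On an explicit bundle with distinguished threads `p ≠ q`, a third thread `t₀`, `O = E ∖ (A p ∪ A q)`, `X = C_u(ω)`, `Y = C_u(E ∖ ω)`:
THEOREM `Coefficientwise.iet_boundary_bundle` — for EVERY up-closed event `𝒱` and ALL monotone real levels `0 ≤ hᵃ, hᵇ ≤ h`, `0 ≤ kᵃ, kᵇ ≤ k`,
  `0 ≤ Σ_{ω ∈ 𝒱, O ⊆ ω, b ∈ X∖Y} h(X) k(X) + Σ_{ω ∈ 𝒱, ω ⊆ A p ∪ A q, b ∈ Y∖X} (hᵃX − hᵇY)(kᵃX − kᵇY)`,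
i.e. the increasing-event-transfer functional with its SUPPLY restricted to the colourings in which all other threads are red and its DEMAND restricted to
those in which all other threads are blue is nonnegative — with no thread-support or regime hypothesis on the levels.  Proof: layer cake
(`iet_of_indicator_levels`) + the 0/1 count (`iet01_ge_count`) + THEOREM BI (`bundle_boundary_count`) + `L₁ ∪ L₂ ⊆ S`.
[cite: KozmaNitzan2024, Questions 8–9 (§5.5 p. 36) (context); Harris 1960]
-/

namespace Summit.CriticalPhenomena.PercolationContinuityZ3.Theorems

open Finset Literature.Probability.Percolation

namespace Coefficientwise

variable {ι V : Type*}

open Classical in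
/-- **Boundary IET on a bundle (all monotone real levels).**  See the module docstring.  [cite: KozmaNitzan2024, Questions 8–9 (§5.5 p. 36) (context); Harris 1960] -/
theorem iet_boundary_bundle (ends : ι → Sym2 V) (r : ℕ) (L : ℕ → ℕ) (hL : ∀ t, t < r → 1 ≤ L t)
    (w : ℕ → ℕ → V) (e : ℕ → ℕ → ι) (u b : V)
    (hw0 : ∀ t, t < r → w t 0 = u) (hwL : ∀ t, t < r → w t (L t) = b)
    (harc : ∀ t, t < r → ∀ j, 1 ≤ j → j ≤ L t → ends (e t j) = s(w t (j - 1), w t j))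
    (hwinj : ∀ t, t < r → ∀ i j, i ≤ L t → j ≤ L t → w t i = w t j → i = j)
    (hcross : ∀ t t', t < r → t' < r → t ≠ t' → ∀ i j, i ≤ L t → j ≤ L t' → w t i = w t' j → (i = 0 ∧ j = 0) ∨ (i = L t ∧ j = L t'))
    (A : ℕ → Finset ι) (hA : ∀ t, t < r → ∀ i, i ∈ A t ↔ ∃ j, 1 ≤ j ∧ j ≤ L t ∧ e t j = i)
    (hAdisj : ∀ t t', t < r → t' < r → t ≠ t' → Disjoint (A t) (A t'))
    (E : Finset ι) (hEA : ∀ i, i ∈ E ↔ ∃ t, t < r ∧ i ∈ A t)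
    (p q : ℕ) (hp : p < r) (hq : q < r) (hpq : p ≠ q) (t₀ : ℕ) (ht₀ : t₀ < r) (ht₀p : t₀ ≠ p) (ht₀q : t₀ ≠ q)
    (𝒱 : Finset ι → Prop) (hV : ∀ ⦃s t : Finset ι⦄, s ⊆ t → 𝒱 s → 𝒱 t)
    (h k ha hb ka kb : Set V → ℝ) (mh : Monotone h) (mk : Monotone k)
    (mha : Monotone ha) (mhb : Monotone hb) (mka : Monotone ka) (mkb : Monotone kb)
    (ha0 : ∀ S, 0 ≤ ha S) (hah : ∀ S, ha S ≤ h S) (hb0 : ∀ S, 0 ≤ hb S) (hbh : ∀ S, hb S ≤ h S)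
    (ka0 : ∀ S, 0 ≤ ka S) (kak : ∀ S, ka S ≤ k S) (kb0 : ∀ S, 0 ≤ kb S) (kbk : ∀ S, kb S ≤ k S) :
    0 ≤ (∑ ω ∈ E.powerset, if (𝒱 ω ∧ E \ (A p ∪ A q) ⊆ ω) ∧ (b ∈ openCluster (ends '' (↑ω : Set ι)) u ∧
          b ∉ openCluster (ends '' (↑(E \ ω) : Set ι)) u) then
        h (openCluster (ends '' (↑ω : Set ι)) u) * k (openCluster (ends '' (↑ω : Set ι)) u) else 0)
      + ∑ ω ∈ E.powerset, if (𝒱 ω ∧ ω ⊆ A p ∪ A q) ∧ (b ∈ openCluster (ends '' (↑(E \ ω) : Set ι)) u ∧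
          b ∉ openCluster (ends '' (↑ω : Set ι)) u) then
        (ha (openCluster (ends '' (↑ω : Set ι)) u) - hb (openCluster (ends '' (↑(E \ ω) : Set ι)) u)) *
          (ka (openCluster (ends '' (↑ω : Set ι)) u) - kb (openCluster (ends '' (↑(E \ ω) : Set ι)) u)) else 0 := by
  set C : Finset ι → Set V := fun ω => openCluster (ends '' (↑ω : Set ι)) u with hC
  set O : Finset ι := E \ (A p ∪ A q) with hO
  have hAE : ∀ t, t < r → A t ⊆ E := fun t ht i hi => (hEA i).mpr ⟨t, ht, hi⟩
  have hPQE : A p ∪ A q ⊆ E := Finset.union_subset (hAE p hp) (hAE q hq)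
  have hEO : E \ O = A p ∪ A q := by rw [hO]; exact Finset.sdiff_sdiff_eq_self hPQE
  refine iet_of_indicator_levels E (fun ω => (𝒱 ω ∧ O ⊆ ω) ∧ (b ∈ C ω ∧ b ∉ C (E \ ω)))
    (fun ω => (𝒱 ω ∧ ω ⊆ A p ∪ A q) ∧ (b ∈ C (E \ ω) ∧ b ∉ C ω)) C (fun ω => C (E \ ω)) ?_
    h k ha hb ka kb mh mk mha mhb mka mkb ha0 hah hb0 hbh ka0 kak kb0 kbk
  intro h k ha hb ka kb mh mk mha mhb mka mkb h01 k01 ha01 hb01 ka01 kb01 hah hbh kak kbk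
  have cnt := iet01_ge_count E (fun ω => (𝒱 ω ∧ O ⊆ ω) ∧ (b ∈ C ω ∧ b ∉ C (E \ ω)))
    (fun ω => (𝒱 ω ∧ ω ⊆ A p ∪ A q) ∧ (b ∈ C (E \ ω) ∧ b ∉ C ω)) C (fun ω => C (E \ ω)) h k ha hb ka kb h01 k01 ha01 hb01 ka01 kb01
  have bi := bundle_boundary_count ends r L hL w e u b hw0 hwL harc hwinj hcross A hA hAdisj E hEA p q hp hq hpq t₀ ht₀ ht₀p ht₀q 𝒱 hV
    ha hb ka kb mha mhb mka mkb ha01 hb01 ka01 kb01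
  -- 0/1 bookkeeping: a sublevel equal to one forces the level to be one
  have up1 : ∀ (f g : Set V → ℝ), (∀ S, g S = 0 ∨ g S = 1) → (∀ S, f S ≤ g S) → ∀ S, f S = 1 → g S = 1 := by
    intro f g g01 hfg S e1
    rcases g01 S with h0 | h0
    · have := hfg S; rw [e1, h0] at this; linarith
    · exact h0
  -- ## the three demand-side counts are the cards of THEOREM BI
  have demand_iff : ∀ ω : Finset ι, (ω ⊆ E ∧ (𝒱 ω ∧ ω ⊆ A p ∪ A q)) ↔ (ω ⊆ A p ∪ A q ∧ 𝒱 ω) := by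
    intro ω
    constructor
    · rintro ⟨-, hv, hsub⟩; exact ⟨hsub, hv⟩
    · rintro ⟨hsub, hv⟩; exact ⟨hsub.trans hPQE, hv, hsub⟩
  have d1 : (∑ ω ∈ E.powerset, if ((𝒱 ω ∧ ω ⊆ A p ∪ A q) ∧ (b ∈ C (E \ ω) ∧ b ∉ C ω)) ∧
        ha (C ω) = 1 ∧ kb (C (E \ ω)) = 1 ∧ hb (C (E \ ω)) = 0 ∧ ka (C ω) = 0 then (1 : ℝ) else 0) =
      ((((A p ∪ A q).powerset).filter (fun ξ => 𝒱 ξ ∧ (b ∈ C (E \ ξ) ∧ b ∉ C ξ) ∧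
        (ha (C ξ) = 1 ∧ kb (C (E \ ξ)) = 1 ∧ hb (C (E \ ξ)) = 0 ∧ ka (C ξ) = 0))).card : ℝ) := by
    rw [Finset.natCast_card_filter, ← Finset.natCast_card_filter, ← Finset.natCast_card_filter]
    congr 1
    apply congrArg Finset.card
    ext ω
    simp only [Finset.mem_filter, Finset.mem_powerset]
    have := demand_iff ω
    tauto
  have d2 : (∑ ω ∈ E.powerset, if ((𝒱 ω ∧ ω ⊆ A p ∪ A q) ∧ (b ∈ C (E \ ω) ∧ b ∉ C ω)) ∧
        hb (C (E \ ω)) = 1 ∧ ka (C ω) = 1 ∧ ha (C ω) = 0 ∧ kb (C (E \ ω)) = 0 then (1 : ℝ) else 0) =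
      ((((A p ∪ A q).powerset).filter (fun ξ => 𝒱 ξ ∧ (b ∈ C (E \ ξ) ∧ b ∉ C ξ) ∧
        (hb (C (E \ ξ)) = 1 ∧ ka (C ξ) = 1 ∧ ha (C ξ) = 0 ∧ kb (C (E \ ξ)) = 0))).card : ℝ) := by
    rw [Finset.natCast_card_filter, ← Finset.natCast_card_filter, ← Finset.natCast_card_filter]
    congr 1
    apply congrArg Finset.card
    ext ω
    simp only [Finset.mem_filter, Finset.mem_powerset]
    have := demand_iff ω
    tauto
  have d3 : (∑ ω ∈ E.powerset, if ((𝒱 ω ∧ ω ⊆ A p ∪ A q) ∧ (b ∈ C (E \ ω) ∧ b ∉ C ω)) ∧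
        ha (C ω) = 1 ∧ ka (C ω) = 1 ∧ hb (C (E \ ω)) = 0 ∧ kb (C (E \ ω)) = 0 then (1 : ℝ) else 0) =
      ((((A p ∪ A q).powerset).filter (fun ξ => 𝒱 ξ ∧ (b ∈ C (E \ ξ) ∧ b ∉ C ξ) ∧
        (ha (C ξ) = 1 ∧ ka (C ξ) = 1 ∧ hb (C (E \ ξ)) = 0 ∧ kb (C (E \ ξ)) = 0))).card : ℝ) := by
    rw [Finset.natCast_card_filter, ← Finset.natCast_card_filter, ← Finset.natCast_card_filter]
    congr 1
    apply congrArg Finset.card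
    ext ω
    simp only [Finset.mem_filter, Finset.mem_powerset]
    have := demand_iff ω
    tauto
  -- ## the supply-side count dominates the target card of THEOREM BI (reindex by `ξ ↦ ξ ∪ O`, `L₁ ∪ L₂ ⊆ S`)
  have supply_card :
      ((((A p ∪ A q).powerset).filter (fun ξ => 𝒱 (ξ ∪ E \ (A p ∪ A q)) ∧
          (b ∈ C (ξ ∪ E \ (A p ∪ A q)) ∧ b ∉ C (E \ (ξ ∪ E \ (A p ∪ A q)))) ∧
          ((ha (C (ξ ∪ E \ (A p ∪ A q))) = 1 ∧ kb (C (ξ ∪ E \ (A p ∪ A q))) = 1 ∧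
              hb (C (E \ (ξ ∪ E \ (A p ∪ A q)))) = 0 ∧ ka (C (E \ (ξ ∪ E \ (A p ∪ A q)))) = 0) ∨
            (ka (C (ξ ∪ E \ (A p ∪ A q))) = 1 ∧ hb (C (ξ ∪ E \ (A p ∪ A q))) = 1 ∧
              kb (C (E \ (ξ ∪ E \ (A p ∪ A q)))) = 0 ∧ ha (C (E \ (ξ ∪ E \ (A p ∪ A q)))) = 0)))).card : ℝ) ≤
      ∑ ω ∈ E.powerset, if ((𝒱 ω ∧ O ⊆ ω) ∧ (b ∈ C ω ∧ b ∉ C (E \ ω))) ∧ h (C ω) = 1 ∧ k (C ω) = 1 then (1 : ℝ) else 0 := by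
    rw [Finset.natCast_card_filter]
    have hinj : Set.InjOn (fun ξ : Finset ι => ξ ∪ O) ↑((A p ∪ A q).powerset) := by
      intro ξ₁ h₁ ξ₂ h₂ heq
      rw [Finset.mem_coe, Finset.mem_powerset] at h₁ h₂
      have d₁ : Disjoint ξ₁ O := by rw [hO]; exact Finset.disjoint_of_subset_left h₁ Finset.disjoint_sdiff
      have d₂ : Disjoint ξ₂ O := by rw [hO]; exact Finset.disjoint_of_subset_left h₂ Finset.disjoint_sdiff
      have e₁ := Finset.union_sdiff_cancel_right d₁
      have e₂ := Finset.union_sdiff_cancel_right d₂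
      have : (ξ₁ ∪ O) \ O = (ξ₂ ∪ O) \ O := by simp only at heq; rw [heq]
      rw [e₁, e₂] at this
      exact this
    have himg : ((A p ∪ A q).powerset).image (fun ξ : Finset ι => ξ ∪ O) ⊆ E.powerset := by
      intro ω hω
      obtain ⟨ξ, hξ, rfl⟩ := Finset.mem_image.mp hω
      rw [Finset.mem_powerset] at hξ ⊢
      exact Finset.union_subset (hξ.trans hPQE) Finset.sdiff_subset
    have nonneg : ∀ ω ∈ E.powerset, ω ∉ ((A p ∪ A q).powerset).image (fun ξ : Finset ι => ξ ∪ O) →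
        (0 : ℝ) ≤ if ((𝒱 ω ∧ O ⊆ ω) ∧ (b ∈ C ω ∧ b ∉ C (E \ ω))) ∧ h (C ω) = 1 ∧ k (C ω) = 1 then (1 : ℝ) else 0 := by
      intro ω _ _; split_ifs <;> norm_num
    refine le_trans ?_ (Finset.sum_le_sum_of_subset_of_nonneg himg nonneg)
    rw [Finset.sum_image hinj]
    refine Finset.sum_le_sum fun ξ _ => ?_
    by_cases hc : 𝒱 (ξ ∪ E \ (A p ∪ A q)) ∧ (b ∈ C (ξ ∪ E \ (A p ∪ A q)) ∧ b ∉ C (E \ (ξ ∪ E \ (A p ∪ A q)))) ∧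
          ((ha (C (ξ ∪ E \ (A p ∪ A q))) = 1 ∧ kb (C (ξ ∪ E \ (A p ∪ A q))) = 1 ∧
              hb (C (E \ (ξ ∪ E \ (A p ∪ A q)))) = 0 ∧ ka (C (E \ (ξ ∪ E \ (A p ∪ A q)))) = 0) ∨
            (ka (C (ξ ∪ E \ (A p ∪ A q))) = 1 ∧ hb (C (ξ ∪ E \ (A p ∪ A q))) = 1 ∧
              kb (C (E \ (ξ ∪ E \ (A p ∪ A q)))) = 0 ∧ ha (C (E \ (ξ ∪ E \ (A p ∪ A q)))) = 0))
    · rw [if_pos hc]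
      obtain ⟨hv, hR, hL⟩ := hc
      have hS : h (C (ξ ∪ O)) = 1 ∧ k (C (ξ ∪ O)) = 1 := by
        rcases hL with ⟨h1, h2, -, -⟩ | ⟨h1, h2, -, -⟩
        · exact ⟨up1 ha h h01 hah _ h1, up1 kb k k01 kbk _ h2⟩
        · exact ⟨up1 hb h h01 hbh _ h2, up1 ka k k01 kak _ h1⟩
      have hfull : ((𝒱 (ξ ∪ O) ∧ O ⊆ ξ ∪ O) ∧ (b ∈ C (ξ ∪ O) ∧ b ∉ C (E \ (ξ ∪ O)))) ∧ h (C (ξ ∪ O)) = 1 ∧ k (C (ξ ∪ O)) = 1 :=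
        ⟨⟨⟨hv, Finset.subset_union_right⟩, hR⟩, hS⟩
      simp only [if_pos hfull, le_refl]
    · rw [if_neg hc]; split_ifs <;> norm_num
  -- ## assemble
  have bi' : ((((A p ∪ A q).powerset).filter (fun ξ => 𝒱 ξ ∧ (b ∈ C (E \ ξ) ∧ b ∉ C ξ) ∧
        (ha (C ξ) = 1 ∧ kb (C (E \ ξ)) = 1 ∧ hb (C (E \ ξ)) = 0 ∧ ka (C ξ) = 0))).card : ℝ) +
      ((((A p ∪ A q).powerset).filter (fun ξ => 𝒱 ξ ∧ (b ∈ C (E \ ξ) ∧ b ∉ C ξ) ∧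
        (hb (C (E \ ξ)) = 1 ∧ ka (C ξ) = 1 ∧ ha (C ξ) = 0 ∧ kb (C (E \ ξ)) = 0))).card : ℝ) ≤
      ((((A p ∪ A q).powerset).filter (fun ξ => 𝒱 (ξ ∪ E \ (A p ∪ A q)) ∧
          (b ∈ C (ξ ∪ E \ (A p ∪ A q)) ∧ b ∉ C (E \ (ξ ∪ E \ (A p ∪ A q)))) ∧
          ((ha (C (ξ ∪ E \ (A p ∪ A q))) = 1 ∧ kb (C (ξ ∪ E \ (A p ∪ A q))) = 1 ∧
              hb (C (E \ (ξ ∪ E \ (A p ∪ A q)))) = 0 ∧ ka (C (E \ (ξ ∪ E \ (A p ∪ A q)))) = 0) ∨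
            (ka (C (ξ ∪ E \ (A p ∪ A q))) = 1 ∧ hb (C (ξ ∪ E \ (A p ∪ A q))) = 1 ∧
              kb (C (E \ (ξ ∪ E \ (A p ∪ A q)))) = 0 ∧ ha (C (E \ (ξ ∪ E \ (A p ∪ A q)))) = 0)))).card : ℝ) +
      ((((A p ∪ A q).powerset).filter (fun ξ => 𝒱 ξ ∧ (b ∈ C (E \ ξ) ∧ b ∉ C ξ) ∧
        (ha (C ξ) = 1 ∧ ka (C ξ) = 1 ∧ hb (C (E \ ξ)) = 0 ∧ kb (C (E \ ξ)) = 0))).card : ℝ) := by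
    have hnat := (Nat.cast_le (α := ℝ)).mpr bi
    rw [Nat.cast_add, Nat.cast_add] at hnat
    exact hnat
  rw [← d1, ← d2, ← d3] at bi'
  refine le_trans ?_ cnt
  have goal' : (0 : ℝ) ≤ (∑ ω ∈ E.powerset, if ((𝒱 ω ∧ O ⊆ ω) ∧ (b ∈ C ω ∧ b ∉ C (E \ ω))) ∧ h (C ω) = 1 ∧ k (C ω) = 1 then (1 : ℝ) else 0)
      + (∑ ω ∈ E.powerset, if ((𝒱 ω ∧ ω ⊆ A p ∪ A q) ∧ (b ∈ C (E \ ω) ∧ b ∉ C ω)) ∧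
          ha (C ω) = 1 ∧ ka (C ω) = 1 ∧ hb (C (E \ ω)) = 0 ∧ kb (C (E \ ω)) = 0 then (1 : ℝ) else 0)
      - (∑ ω ∈ E.powerset, if ((𝒱 ω ∧ ω ⊆ A p ∪ A q) ∧ (b ∈ C (E \ ω) ∧ b ∉ C ω)) ∧
          ha (C ω) = 1 ∧ kb (C (E \ ω)) = 1 ∧ hb (C (E \ ω)) = 0 ∧ ka (C ω) = 0 then (1 : ℝ) else 0)
      - (∑ ω ∈ E.powerset, if ((𝒱 ω ∧ ω ⊆ A p ∪ A q) ∧ (b ∈ C (E \ ω) ∧ b ∉ C ω)) ∧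
          hb (C (E \ ω)) = 1 ∧ ka (C ω) = 1 ∧ ha (C ω) = 0 ∧ kb (C (E \ ω)) = 0 then (1 : ℝ) else 0) := by
    linarith [bi', supply_card]
  convert goal' using 2

end Coefficientwise

end Summit.CriticalPhenomena.PercolationContinuityZ3.Theorems
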